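import Mathlib
import Summits.Ventures.FusionMHD.Models.SAlphaSecondStableS2A433Core0
import HarnessLib

/-!
# STABLE-POINT core at `(2, 433/100)`, piece 8 (`[4, 6]`): kernel-decided Taylor-model leaves ⇒ `F_8 > 0` and `amplitudeResidual 2 (433/100) F_8 F_8″ ≤ 0` on the piece ⇒ `EnergyDominatesOn` for its amplitude phase

LADDER-GRIDFUSION rung F3 («F3.BALLOON-sα-S2-SECOND-EDGE-HALVING-A433»: the second-edge bracket at s = 2 HALVED from the stable side ([417/100, 9/2] → [417/100, 433/100]) (DIRECTOR RULING 67 (5) class / I4107 (2))); gridfusion-model-7 g10, 2026-08-28 (g8/g9 core lane).  Two `decide +kernel` calls (`OpModel.trig.pLeavesCheck`, scale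
`2^60`, Taylor degree 10, 16 leaves of half-width 1/16) and the lane's soundness theorem `OpSem.trig.pos_of_pLeavesCheck`
(Literature/Analysis/ValidatedNumerics/TaylorModelZeroCert); lit-4's `energyDominatesOn_of_amplitude` (BallooningSAlphaStableSide) turns the two
sign facts into energy domination by `amplitudePhase 2 (433/100) F_8 F_8′` on the piece.  MODELLED: `s–α` model; nothing about a device.
No `native_decide`.  Citations: Freidberg 2014 §12.6.2 (12.97) [Freidberg2014]; Makino–Berz 2003 Alg. 2 [MakinoBerz2003]; Hartman 2002 XI.6.2
[Hartman2002].  Everything here is [instance data].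
-/

open Literature.Analysis.ValidatedNumerics Literature.Analysis.ValidatedNumerics.PolyMP
open Literature.Analysis.ValidatedNumerics.NumericsMP Literature.Analysis.ValidatedNumerics.ExpPoly
open Literature.MathematicalPhysics.MHD.Ballooning
open Real Set

namespace Summit.Ventures.FusionMHD.Models

namespace SAlphaSecondStableS2A433

/-- KERNEL CHECK (residual leaves of piece 8). [instance data] -/
theorem ss2433_res8_ok : OpModel.trig.pLeavesCheck ss2433Prm (2 ^ 60) (ss2433Prog N8 (Poly.deriv (Poly.deriv N8))) [] ss2433Leaves8 = true := by
  decide +kernel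

/-- KERNEL CHECK (positivity leaves of piece 8). [instance data] -/
theorem ss2433_pos8_ok : OpModel.trig.pLeavesCheck ss2433Prm (2 ^ 60) (ss2433PosProg N8) [] ss2433Leaves8 = true := by
  decide +kernel

/-- The leaves tile `[4, 6]`. [instance data] -/
theorem ss2433_tiles8 : tiles (4 : ℚ) (ss2433Leaves8.map fun l => (l.e, l.k)) (6 : ℚ) = true := by
  decide +kernel

/-- **PIECE 8**: the phase of `F_8` dominates the `s–α` energy on `[4, 6]` at `(s, α) = (2, 433/100)`. [instance data] -/
theorem ss2433_dominates8 :
    SAlpha.EnergyDominatesOn 2 (433 / 100) (SAlpha.amplitudePhase 2 (433 / 100) (Poly.eval N8) (Poly.eval (Poly.deriv N8)))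
      (Icc (4 : ℝ) (6 : ℝ)) := by
  have h := ss2433_dominates (lf := N8) (x := 4) (y := 6) (by norm_num) ss2433_tiles8 ss2433_res8_ok ss2433_pos8_ok
  norm_num at h
  exact h

end SAlphaSecondStableS2A433

end Summit.Ventures.FusionMHD.Models
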